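/-
Literature/AlgebraicGeometry/ComplexMultiplication/CyclicTwoPowerTimesPrimeCMTypes.lean — pub-hodgecm2 (COR-CM), KEPT Literature lane lit-deligne-3
gen 63, file F63a.  THEOREMS ONLY (no `def`, no named fact, no `sorry`, no instance, no notation; D-0026 net debt 0).  HC_CM is NOT proved.
-/
import Literature.AlgebraicGeometry.ComplexMultiplication.CyclicTwoPowerCMTypesFermat
import Literature.AlgebraicGeometry.Pohlmann1968.DegenerateCMTypesCyclicCMFieldTwoOddPrimes
import Literature.AlgebraicGeometry.Pohlmann1968.CMFieldDegreeLeSixAllPowersHodgeConjecture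
import Literature.NumberTheory.NumberFields.CyclotomicGaussianIndependence
import Literature.AlgebraicGeometry.Motives.AbelianVarietyBiproductIsogenies
import HarnessLib

/-!
# CM fields with CYCLIC Galois group of order `2^{k+1}·p` (`p` an odd prime): every PRIMITIVE CM type is nondegenerate,
# every imprimitive one is induced from the cyclic `2`-power CM subfield — `B•(Aⁿ) ⊗ ℂ = D•(Aⁿ) ⊗ ℂ` and the Hodge
# conjecture for all powers of EVERY abelian variety with complex multiplication by such a field (`ℚ(ζ₂₅)`, `ℚ(ζ₂₉)`, …)

Layer `Literature/AlgebraicGeometry/ComplexMultiplication`, namespace `Literature.AlgebraicGeometry.ComplexMultiplication.CyclicTwoPowerTimesPrime`;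
sequel of lit-hodgefound's `CyclicTwoPowerCMTypes` ∕ `CyclicTwoPowerCMTypesFermat` (cyclic `2`-power Galois groups: EVERY type
nondegenerate) and of the tree's Tankeev–Ribet–Yanai prime theorem (`isNondegenerate_of_isPrimitive_of_prime`, degree `2p`), written by the
KEPT lane `lit-deligne-3` (gen 63) for the level `ℚ(ζ₂₅)` (degree `20 = 2²·5`) of its «`φ(N) ≤ 22`» programme, in the natural generality.

THE THEOREM.  Let `K` be a CM field whose Galois group `G = Gal(K/ℚ)` is CYCLIC of order `2^{k+1}·p`, `p` an odd prime, `k ≥ 0`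
(`k = 0` is the prime theorem's `2p`; `p` absent is the `2`-power theorem).  Then:
* every PRIMITIVE CM type `Φ` of `K` is NONDEGENERATE (Kubota rank `2^k p + 1`) — so nondegenerate ⟺ primitive (§3);
* the CM subfields of `K` are `K` and the cyclic `2`-power CM field `K₁ = K^{⟨u⟩}` of degree `2^{k+1}` (`u` of order `p`), all of whose
  types are nondegenerate; so EVERY CM type of `K` is primitive-nondegenerate or induced from a nondegenerate type of `K₁` (§3);
* consequently EVERY abelian variety `(A, ι, θ)` with complex multiplication by `K` — any type, simple or not — has
  `Bᵐ(Aⁿ) ⊗ ℂ = Dᵐ(Aⁿ) ⊗ ℂ` for all `n, m` and satisfies the Hodge conjecture together with all its powers, UNCONDITIONALLY (§3); the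
  same for every complex abelian variety of dimension `2^k p` with a ring homomorphism `K → End⁰` (§4); in particular for the
  cyclotomic fields `ℚ(ζ_q)` with `(ℤ/q)ˣ` cyclic of order `2^{k+1} p`: `q = 25` (the missing level of `φ(N) ≤ 22`), `29, 41, 53, …` (§4).

THE PROOF (elementary; the argument of `CyclicTwoPowerCMTypes` run over `ℚ(ζ_p)` instead of `ℚ`).  By Kubota's Lemma 2 (tree
`isNondegenerate_iff_forall_oddCharacters`) degeneracy means that an ODD character `χ` of `G = ⟨γ⟩` (`χ(ρ) = −1`) vanishes on the type
`S = {g : σ_g ∈ Φ}`.  Put `g₂ = γ^p` (order `2^{k+1}`), `u = γ^{2^{k+1}}` (order `p`), `α = χ(g₂)`, `β = χ(u)`: the involution is `ρ = g₂^{2^k}`, so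
`α^{2^k} = −1` and `β^p = 1`; every element is uniquely `g₂^x u^y` (`x < 2^{k+1}`, `y < p`) and `ρ` pairs `(x, y)` with `(x + 2^k, y)`, whence
`χ(S) = Σ_{x<2^k} α^x · Σ_{y<p} ε(x,y) β^y` with signs `ε = ±1` (§2).  The powers `1, α, …, α^{2^k−1}` are linearly independent over `ℚ(β)`:
`[ℚ(β)(α) : ℚ(β)] = 2^k` because `ℚ(β)(α) ⊇ ℚ(αβ) = ℚ(ζ_{2^{k+1}p})` has degree `2^k (p−1)` (resp. `2^k`) over `ℚ` (§1, irreducibility of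
cyclotomic polynomials over `ℚ`).  So each `Σ_y ε(x,y) β^y` vanishes: impossible for `β = 1` (a sum of `p` odd signs), and for `β` a primitive
`p`-th root of unity forcing `ε(x, ·)` constant (`1, β, …, β^{p−1}` have the single relation `Σ = 0`), i.e. `uS = S`.  A stabiliser `u ≠ 1`
contradicts primitivity (Shimura §8.2 Prop. 26 ∕ Hazama Prop. 2.3, tree `CyclicTwoOddPrimes.isPrimitive_iff`).  For imprimitive types:
a proper CM subfield `K₁` has `ρ ∉ Gal(K/K₁)` (`K₁` totally complex), hence `[K : K₁]` odd (the involution of a cyclic group lies in every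
subgroup of even order), hence `[K : K₁] = p`, `[K₁ : ℚ] = 2^{k+1}`, `Gal(K₁/ℚ)` cyclic — and Hazama's criterion for induced types
(tree `IsNondegenerate.hodgeClassSpan_pow_eq_divisorClassesSpan_inducedCMType`) finishes.

PRESEARCH (lane rule): the statement «cyclic of order `2^a p` ⟹ primitive types nondegenerate» was not found in print as such —
Dodson 1984 §3.2.1 (degenerate primitive types on `⟨ρ⟩ × ℤ_n`, `n = kl` — the SPLIT groups; for `n = 2^{k} p` even the cyclic group is
non-split), Dodson 1987 §4 + Additional Remark, Mai 1989 (lower bounds), Hazama 2003 §1 (cyclic `2pq`), Kubota 1965 §4, Gordon §9.4 read;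
numerical check (all types): `C₁₂, C₂₀, C₂₄, C₂₈, C₄₀` — `0` primitive degenerate types; control `C₃₆` (`p = 9` not prime) — `3132`.
The ingredients are Kubota's Lemma 2, Hazama's Prop. 2.1 ∕ 2.3 ∕ (4.1) and Washington Ch. 2 (degrees of cyclotomic fields), each
cited at its use.

## What is proved

* §1 `isPrimitiveRoot_of_pow_two_pow_eq_neg_one`, (private) `isPrimitiveRoot_of_pow_prime_eq_one`,
  **`linearIndependent_pow_of_pow_two_pow_eq_neg_one`** (`1, α, …, α^{2^k−1}` free over `ℚ(β)`), `forall_eq_zero_of_sum_pow_mul_eq_zero`.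
* §2 (abstract cyclic group `⟨γ⟩` of order `2^{k+1} p`, commutative `G`): (private plumbing `orderOf_pow_prime`, `orderOf_pow_two_pow`,
  `coord_injective`, `coord_bijective`), **`isStableUnder_of_sum_eq_zero`** (odd `χ` with `χ(S) = 0` ⟹ `uS = S`), **`sum_eq_zero_iff_isStableUnder`**
  (`χ(S) = 0 ⟺ uS = S ∧ χ(u) ≠ 1`).
* §3 (`K` CM, `IsAbelianGalois ℚ K`, `Gal` cyclic of order `2^{k+1} p`): **`isNondegenerate_of_isPrimitive_of_isCyclic`**,
  **`isNondegenerate_iff_isPrimitive_of_isCyclic`**, `cmTypeRank_eq_of_isPrimitive_of_isCyclic` (`2^k p + 1`),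
  **`finrank_eq_two_pow_of_isCMField_of_lt`** (a proper CM subfield has `[K:K₁] = p`, `[K₁:ℚ] = 2^{k+1}`), `isNondegenerate_of_intermediateField_of_isCyclic`,
  **`isNondegenerate_or_exists_inducedCMType_of_isCyclic`** (the dichotomy), **`hodgeClassSpan_pow_eq_divisorClassesSpan_of_isCyclic`**,
  **`hodgeConjectureFor_pow_of_isCyclic`**, `not_exists_exceptional_pow_of_isCyclic`, `hodgeConjectureFor_of_isCyclic`,
  `dim_eq_and_isSimple_iff_isNondegenerate_of_isCyclic`.
* §4 intrinsic (`φ : K → End⁰(B)`, `dim B = 2^k p`): `hodgeConjectureFor_pow_of_ringHom_of_isCyclic`, `hodgeConjectureFor_of_ringHom_of_isCyclic`;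
  cyclotomic `ℚ(ζ_q)`, `(ℤ/q)ˣ` cyclic, `φ(q) = 2^{k+1} p`: `cm_abelian_cyclic_finrank_of_isCyclotomicExtension`,
  `isNondegenerate_iff_isPrimitive_of_isCyclotomicExtension`, `hodgeClassSpan_pow_eq_divisorClassesSpan_of_isCyclotomicExtension`,
  **`hodgeConjectureFor_pow_of_isCyclotomicExtension`**, `hodgeConjectureFor_of_isCyclotomicExtension`, `hodgeConjectureFor_pow_of_ringHom_of_isCyclotomicExtension`;
  levels: **`hodgeConjectureFor_pow_of_isCyclotomicExtension_twentyFive`** (+ `hodgeClassSpan_pow_eq_…_twentyFive`,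
  `isNondegenerate_iff_isPrimitive_…_twentyFive`, `hodgeConjectureFor_pow_of_ringHom_twentyFive`: every complex abelian TENFOLD with an action of
  `ℚ(ζ₂₅)`), `…_twentyNine`, `…_fortyOne`, `…_fiftyThree`.

HONEST REGISTER.  Unconditional theorems about CM abelian varieties of the stated fields only; for cyclic groups of order `2^a m` with `m`
composite odd (`C₁₈ ⊃` Serre's `ℚ(ζ₁₉)` type, `C₃₆`, Hazama's `C_{2pq}`) primitive degenerate types DO exist and nothing is claimed.  The Hodge
conjecture for CM abelian varieties in general (`HC_CM`) is NOT proved and not used.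

## References

* [Kubota1965] T. Kubota, *On the field extension by complex multiplication*, Trans. AMS 118 (1965), §2 (p. 115), §4 Lemma 2.
* [Yanai1985] H. Yanai, *On degenerate CM-types*, J. Number Theory 21 (1985), §4 Theorem (p. 171).
* [Hazama2003CyclicCM] F. Hazama, J. Math. Sci. Univ. Tokyo 10 (2003), Prop. 2.1, Prop. 2.3, (4.1), Lemma 4.6.1, Thm. 4.8 (iii).
* [Gordon1999HodgeAVSurvey] B. B. Gordon, *A survey of the Hodge conjecture for abelian varieties*, Thm. 6.4, §9.3, 9.4.1.
* [Washington1997] L. C. Washington, *Introduction to Cyclotomic Fields*, Ch. 2, Prop. 2.4, Thm. 2.5.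
* [Shimura1998] G. Shimura, *Abelian Varieties with Complex Multiplication and Modular Functions*, §5.2, §6.2 Thm. 3, §7.1 Prop. 7,
  §8.2 Prop. 26, §18.2 Lemma (i).
* [Dodson1984] B. Dodson, Trans. AMS 283 (1984), §1.1, §3.2.1, Prop. 5.2.2.
* [Streng2010] M. Streng, PhD thesis (Leiden 2010), Ch. I Lemma 3.5.
* [vanGeemen1994HodgeAV] B. van Geemen, LNM 1594 (1994), §3.7 Lemma 3.7.
* [Deligne2000] P. Deligne, *The Hodge conjecture* (Clay, 2000), §1.

## Provenance

Cell `pub-hodgecm2` (COR-CM), KEPT Literature lane `lit-deligne-3` gen 63 (claim CYCLIC-TWO-POWER-TIMES-PRIME-NONDEGENERATE; count-neutral,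
own lane), file F63a.  Theorems only; net Literature debt 0.
-/

noncomputable section

open scoped BigOperators IsMulCommutative
open Polynomial IntermediateField

namespace Literature.AlgebraicGeometry.ComplexMultiplication.CyclicTwoPowerTimesPrime

open Literature.NumberTheory.ComplexMultiplication
open Literature.NumberTheory.ComplexMultiplication.CyclicCMType (IsStableUnder rho_mul_mem_iff sum_char_eq_zero_of_stable)
open Literature.AlgebraicGeometry.ComplexMultiplication.CyclicTwoPower (involution_eq_pow)
open Literature.NumberTheory.NumberFields.CyclotomicGaussian (finrank_adjoin_eq_totient eq_of_sum_mul_pow_eq_zero)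

/-! ## §1 Roots of unity: the powers of a primitive `2^{k+1}`-th root of unity are free over `ℚ(ζ_p)` -/

section Roots

/-- `α^{2^k} = -1` makes `α` a primitive `2^{k+1}`-th root of unity (a root of `Φ_{2^{k+1}} = X^{2^k} + 1`).
[cite: Washington1997, Ch. 2 Thm. 2.5] -/
theorem isPrimitiveRoot_of_pow_two_pow_eq_neg_one {k : ℕ} {α : ℂ} (hα : α ^ 2 ^ k = -1) :
    IsPrimitiveRoot α (2 ^ (k + 1)) := by
  have hcyc : cyclotomic (2 ^ (k + 1)) ℂ = X ^ 2 ^ k + 1 := by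
    rw [cyclotomic_prime_pow_eq_geom_sum Nat.prime_two, Finset.sum_range_succ, Finset.sum_range_one, pow_zero,
      pow_one, add_comm]
  haveI : NeZero ((2 ^ (k + 1) : ℕ) : ℂ) := ⟨by exact_mod_cast (pow_ne_zero (k + 1) two_ne_zero)⟩
  rw [← isRoot_cyclotomic_iff, hcyc, IsRoot.def, eval_add, eval_pow, eval_X, eval_one, hα, neg_add_cancel]

/-- A `p`-th root of unity, `p` prime, is `1` or a primitive `p`-th root of unity. [folklore] -/
private theorem isPrimitiveRoot_of_pow_prime_eq_one {p : ℕ} (hp : p.Prime) {β : ℂ} (hβ : β ^ p = 1) (hβ1 : β ≠ 1) :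
    IsPrimitiveRoot β p := by
  haveI := Fact.mk hp
  have h := orderOf_eq_prime hβ hβ1
  rw [← h]
  exact IsPrimitiveRoot.orderOf β

/-- **`[ℚ(ζ_p)(α) : ℚ(ζ_p)] = 2^k` for a primitive `2^{k+1}`-th root of unity `α` and a `p`-th root of unity `β` (`p` an odd
prime): the powers `1, α, …, α^{2^k − 1}` are linearly independent over `ℚ(β)`** — `ℚ(β)(α) ⊇ ℚ(αβ)` has degree
`φ(2^{k+1}p) = 2^k (p − 1)` over `ℚ` (resp. `2^k` if `β = 1`), while `[ℚ(β) : ℚ] = p − 1` (resp. `1`) and the minimal polynomial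
of `α` over `ℚ(β)` divides `X^{2^k} + 1`. [cite: Washington1997, Ch. 2 Thm. 2.5 and Prop. 2.4] -/
theorem linearIndependent_pow_of_pow_two_pow_eq_neg_one {k p : ℕ} (hp : p.Prime) (hp2 : p ≠ 2) {α β : ℂ}
    (hα : α ^ 2 ^ k = -1) (hβ : β ^ p = 1) :
    LinearIndependent ℚ⟮β⟯ fun i : Fin (2 ^ k) => α ^ (i : ℕ) := by
  have hm : 0 < 2 ^ k := by positivity
  have htot2 : Nat.totient (2 ^ (k + 1)) = 2 ^ k := by rw [Nat.totient_prime_pow_succ Nat.prime_two]; simp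
  set F : IntermediateField ℚ ℂ := ℚ⟮β⟯ with hF_def
  have hαprim : IsPrimitiveRoot α (2 ^ (k + 1)) := isPrimitiveRoot_of_pow_two_pow_eq_neg_one hα
  have h2k : 0 < 2 ^ (k + 1) := by positivity
  -- `β` is integral, `F` is finite over `ℚ`
  have hβint : IsIntegral ℚ β := by
    refine ⟨X ^ p - 1, monic_X_pow_sub_C (1 : ℚ) hp.ne_zero, ?_⟩
    simp [hβ]
  haveI hFfin : FiniteDimensional ℚ F := adjoin.finiteDimensional hβint
  have hαintQ : IsIntegral ℚ α := (hαprim.isIntegral h2k).tower_top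
  have hαint : IsIntegral F α := hαintQ.tower_top
  haveI hFαfin : FiniteDimensional F F⟮α⟯ := adjoin.finiteDimensional hαint
  -- upper bound: `minpoly_F(α) ∣ X^m + 1`
  have hdvd : minpoly F α ∣ (X ^ 2 ^ k + 1 : F[X]) :=
    minpoly.dvd F α (by rw [map_add, map_pow, aeval_X, map_one, hα, neg_add_cancel])
  have hXm : (X ^ 2 ^ k + 1 : F[X]) ≠ 0 := by
    rw [show (X ^ 2 ^ k + 1 : F[X]) = X ^ 2 ^ k + C 1 by rw [C_1]]; exact X_pow_add_C_ne_zero hm 1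
  have hle : (minpoly F α).natDegree ≤ 2 ^ k := by
    have h := natDegree_le_of_dvd hdvd hXm
    rwa [show (X ^ 2 ^ k + 1 : F[X]) = X ^ 2 ^ k + C 1 by rw [C_1], natDegree_X_pow_add_C] at h
  -- lower bound: `m · [F : ℚ] ≤ [F(α) : ℚ]` because `F(α) ⊇ ℚ(αβ)`
  have htower : Module.finrank ℚ F * Module.finrank F F⟮α⟯ = Module.finrank ℚ F⟮α⟯ := Module.finrank_mul_finrank ℚ F F⟮α⟯
  have hsub : ℚ⟮α * β⟯ ≤ (F⟮α⟯).restrictScalars ℚ := by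
    rw [adjoin_simple_le_iff, mem_restrictScalars]
    exact mul_mem (mem_adjoin_simple_self F α)
      (algebraMap F F⟮α⟯ ⟨β, mem_adjoin_simple_self ℚ β⟩).2
  haveI : FiniteDimensional ℚ ((F⟮α⟯).restrictScalars ℚ) := by
    change FiniteDimensional ℚ F⟮α⟯
    exact Module.Finite.trans F F⟮α⟯
  have hge' : Module.finrank ℚ ℚ⟮α * β⟯ ≤ Module.finrank ℚ F⟮α⟯ := by
    have h := IntermediateField.finrank_le_of_le_right hsub
    exact h
  have hkey : 2 ^ k * Module.finrank ℚ F ≤ Module.finrank ℚ F⟮α⟯ := by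
    refine le_trans (le_of_eq ?_) hge'
    -- `[ℚ(αβ) : ℚ] = m · [ℚ(β) : ℚ]`, by cases on `β = 1`
    by_cases hβ1 : β = 1
    · have hF1 : Module.finrank ℚ F = 1 := by
        rw [hF_def, hβ1, IntermediateField.finrank_eq_one_iff, adjoin_simple_eq_bot_iff]
        exact one_mem _
      rw [hF1, mul_one, hβ1, mul_one, finrank_adjoin_eq_totient h2k hαprim, htot2]
    · have hβprim : IsPrimitiveRoot β p := isPrimitiveRoot_of_pow_prime_eq_one hp hβ hβ1
      have hcop : Nat.Coprime (2 ^ (k + 1)) p :=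
        ((Nat.coprime_primes Nat.prime_two hp).2 (Ne.symm hp2)).pow_left (k + 1)
      have hαβ : IsPrimitiveRoot (α * β) (2 ^ (k + 1) * p) := by
        rw [IsPrimitiveRoot.iff_orderOf, (Commute.all α β).orderOf_mul_eq_mul_orderOf_of_coprime]
        · rw [← hαprim.eq_orderOf, ← hβprim.eq_orderOf]
        · rwa [← hαprim.eq_orderOf, ← hβprim.eq_orderOf]
      rw [hF_def, finrank_adjoin_eq_totient hp.pos hβprim, finrank_adjoin_eq_totient (Nat.mul_pos h2k hp.pos) hαβ,
        Nat.totient_mul hcop, htot2, Nat.totient_prime hp]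
  have hge : 2 ^ k ≤ (minpoly F α).natDegree := by
    rw [← adjoin.finrank hαint]
    have hFpos : 0 < Module.finrank ℚ F := Module.finrank_pos
    rw [← htower, mul_comm] at hkey
    exact Nat.le_of_mul_le_mul_left hkey hFpos
  have hdeg : (minpoly F α).natDegree = 2 ^ k := le_antisymm hle hge
  have h := linearIndependent_pow (K := F) α
  rw [hdeg] at h
  exact h

/-- **The relation `Σ_{x < 2^k} α^x d_x = 0` with `d_x ∈ ℚ(β)` forces every `d_x = 0`** (`α^{2^k} = -1`, `β^p = 1`, `p` an odd
prime). [cite: Washington1997, Ch. 2 Prop. 2.4] -/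
theorem forall_eq_zero_of_sum_pow_mul_eq_zero {k p : ℕ} (hp : p.Prime) (hp2 : p ≠ 2) {α β : ℂ}
    (hα : α ^ 2 ^ k = -1) (hβ : β ^ p = 1) (d : Fin (2 ^ k) → ℂ) (hd : ∀ x, d x ∈ ℚ⟮β⟯)
    (h0 : ∑ x : Fin (2 ^ k), α ^ (x : ℕ) * d x = 0) : ∀ x, d x = 0 := by
  have hli := linearIndependent_pow_of_pow_two_pow_eq_neg_one hp hp2 hα hβ
  rw [Fintype.linearIndependent_iff] at hli
  have h := hli (fun x => ⟨d x, hd x⟩) (by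
    rw [← h0]
    refine Finset.sum_congr rfl fun x _ => ?_
    rw [IntermediateField.smul_def, smul_eq_mul, mul_comm])
  intro x
  have hx := h x
  exact congrArg Subtype.val hx

end Roots

/-! ## §2 The cyclic group of order `2^{k+1}·p`: an odd character that vanishes on a CM type forces stability under the
subgroup of order `p` -/

section Group

variable {G : Type*} [CommGroup G] [Fintype G] [DecidableEq G] {γ ρ : G} {k p : ℕ}

omit [Fintype G] [DecidableEq G] in
/-- In the cyclic group generated by `γ` of order `2^{k+1}·p` (`p` an odd prime): `γ^p` has order `2^{k+1}`. [folklore] -/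
private theorem orderOf_pow_prime (hp : p.Prime) (hγ : orderOf γ = 2 ^ (k + 1) * p) : orderOf (γ ^ p) = 2 ^ (k + 1) := by
  rw [orderOf_pow' γ hp.ne_zero, hγ, Nat.gcd_mul_left_left, Nat.mul_div_cancel _ hp.pos]

omit [Fintype G] [DecidableEq G] in
/-- … and `γ^{2^{k+1}}` has order `p`. [folklore] -/
private theorem orderOf_pow_two_pow (hγ : orderOf γ = 2 ^ (k + 1) * p) : orderOf (γ ^ 2 ^ (k + 1)) = p := by
  rw [orderOf_pow' γ (pow_ne_zero _ two_ne_zero), hγ, Nat.gcd_mul_right_left, Nat.mul_div_cancel_left _ (by positivity)]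

omit [Fintype G] [DecidableEq G] in
/-- **Coordinates `(x, y) ↦ (γ^p)^x (γ^{2^{k+1}})^y`, `x < 2^{k+1}`, `y < p`, are injective** (`gcd(2^{k+1}, p) = 1`). [folklore] -/
private theorem coord_injective (hp : p.Prime) (hp2 : p ≠ 2) (hγ : orderOf γ = 2 ^ (k + 1) * p) {x x' y y' : ℕ}
    (hx : x < 2 ^ (k + 1)) (hx' : x' < 2 ^ (k + 1)) (hy : y < p) (hy' : y' < p)
    (h : (γ ^ p) ^ x * (γ ^ 2 ^ (k + 1)) ^ y = (γ ^ p) ^ x' * (γ ^ 2 ^ (k + 1)) ^ y') : x = x' ∧ y = y' := by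
  have hN := orderOf_pow_prime hp hγ
  have hP := orderOf_pow_two_pow hγ
  have hcop : Nat.Coprime (2 ^ (k + 1)) p := ((Nat.coprime_primes Nat.prime_two hp).2 (Ne.symm hp2)).pow_left (k + 1)
  have hu1 : (γ ^ 2 ^ (k + 1)) ^ p = 1 := by rw [← hP]; exact pow_orderOf_eq_one _
  have key : ∀ a b : ℕ, ((γ ^ p) ^ a * (γ ^ 2 ^ (k + 1)) ^ b) ^ p = ((γ ^ p) ^ a) ^ p := fun a b => by
    rw [mul_pow, pow_right_comm (γ ^ 2 ^ (k + 1)) b p, hu1, one_pow, mul_one]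
  have h1 : (γ ^ p) ^ (x * p) = (γ ^ p) ^ (x' * p) := by rw [pow_mul, pow_mul, ← key x y, ← key x' y', h]
  rw [pow_eq_pow_iff_modEq, hN] at h1
  have hxx : x = x' := Nat.ModEq.eq_of_lt_of_lt (Nat.ModEq.cancel_right_of_coprime hcop h1) hx hx'
  subst hxx
  refine ⟨rfl, ?_⟩
  have h2 : (γ ^ 2 ^ (k + 1)) ^ y = (γ ^ 2 ^ (k + 1)) ^ y' := mul_left_cancel h
  rw [pow_eq_pow_iff_modEq, hP] at h2
  exact Nat.ModEq.eq_of_lt_of_lt h2 hy hy'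

omit [DecidableEq G] in
/-- **The coordinates `(x, y) ↦ (γ^p)^x u^y` and `(x, y) ↦ (γ^p)^{x + 2^k} u^y` (`u = γ^{2^{k+1}}`, `x < 2^k`, `y ∈ ℤ/p`)
together enumerate `G` bijectively.** [folklore] -/
private theorem coord_bijective [hp : Fact p.Prime] (hp2 : p ≠ 2) (hγ : orderOf γ = 2 ^ (k + 1) * p)
    (hgen : ∀ x : G, x ∈ Submonoid.powers γ) :
    Function.Bijective (fun z : (Fin (2 ^ k) × ZMod p) ⊕ (Fin (2 ^ k) × ZMod p) =>
      Sum.elim (fun xy : Fin (2 ^ k) × ZMod p => (γ ^ p) ^ (xy.1 : ℕ) * (γ ^ 2 ^ (k + 1)) ^ xy.2.val)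
        (fun xy : Fin (2 ^ k) × ZMod p => (γ ^ p) ^ ((xy.1 : ℕ) + 2 ^ k) * (γ ^ 2 ^ (k + 1)) ^ xy.2.val) z) := by
  have hN : 2 ^ (k + 1) = 2 * 2 ^ k := by rw [pow_succ, mul_comm]
  rw [Fintype.bijective_iff_injective_and_card]
  refine ⟨?_, ?_⟩
  · rintro (⟨x, y⟩ | ⟨x, y⟩) (⟨x', y'⟩ | ⟨x', y'⟩) h <;> simp only [Sum.elim_inl, Sum.elim_inr] at h
    · obtain ⟨h1, h2⟩ := coord_injective hp.out hp2 hγ (by omega) (by omega) y.val_lt y'.val_lt h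
      rw [Fin.ext h1, ZMod.val_injective p h2]
    · obtain ⟨h1, -⟩ := coord_injective hp.out hp2 hγ (by omega) (by omega) y.val_lt y'.val_lt h
      omega
    · obtain ⟨h1, -⟩ := coord_injective hp.out hp2 hγ (by omega) (by omega) y.val_lt y'.val_lt h
      omega
    · obtain ⟨h1, h2⟩ := coord_injective hp.out hp2 hγ (by omega) (by omega) y.val_lt y'.val_lt h
      rw [Fin.ext (by omega : (x : ℕ) = x'), ZMod.val_injective p h2]
  · have h := orderOf_eq_card_of_forall_mem_powers hgen
    rw [Nat.card_eq_fintype_card, hγ] at h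
    rw [← h, Fintype.card_sum, Fintype.card_prod, Fintype.card_fin, ZMod.card, hN]
    ring

/-- **THE KEY LEMMA.  In the cyclic group `G = ⟨γ⟩` of order `2^{k+1}·p` (`p` an odd prime), an ODD character `χ`
(`χ(ρ) = −1`, `ρ` the involution) that vanishes on a CM type `Φ` (`Φ ⊔ ρΦ = G`) forces `Φ` to be STABLE under
`u = γ^{2^{k+1}}`, the generator of the subgroup of order `p`.**  Proof: in the coordinates `g₂^x u^y` (`g₂ = γ^p`,
`ρ = g₂^{2^k}`) one has `χ(Φ) = Σ_{x<2^k} α^x · Σ_{y} ε(x,y) β^y` with `α = χ(g₂)`, `α^{2^k} = −1`, `β = χ(u)`, `β^p = 1`,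
`ε = ±1`; the powers `α^x` are free over `ℚ(β)` (§1), so every `Σ_y ε(x,y) β^y` vanishes — impossible if `β = 1` (`p` odd
terms `±1`), and forcing `ε(x,·)` constant if `β` is a primitive `p`-th root of unity, i.e. `uΦ = Φ`.  (Kubota's Lemma 2 turns
this into nondegeneracy of primitive types, §3.) [cite: Kubota1965, §4 Lemma 2] [cite: Hazama2003CyclicCM, Prop. 2.1, Prop. 2.3 and (4.1)]
[cite: Washington1997, Ch. 2 Prop. 2.4] -/
theorem isStableUnder_of_sum_eq_zero [hp : Fact p.Prime] (hp2 : p ≠ 2) (hγ : orderOf γ = 2 ^ (k + 1) * p)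
    (hgen : ∀ x : G, x ∈ Submonoid.powers γ) {Φ : Finset G} (hΦ : IsCMTypeWith ρ (Φ : Set G))
    (χ : AddChar (Additive G) ℂ) (hχ : χ (Additive.ofMul ρ) = -1) (h0 : ∑ s ∈ Φ, χ (Additive.ofMul s) = 0) :
    IsStableUnder Φ (γ ^ 2 ^ (k + 1)) := by
  have hN : 2 ^ (k + 1) = 2 * 2 ^ k := by rw [pow_succ, mul_comm]
  have hP := orderOf_pow_two_pow hγ
  -- the involution is `ρ = (γ^p)^{2^k}`
  have hρ1 : ρ ≠ 1 := by
    intro h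
    have := hΦ.rho_smul_ne (1 : G)
    rw [h, smul_eq_mul, one_mul] at this
    exact this rfl
  have hρ2 : ρ * ρ = 1 := by
    have := hΦ.invol (1 : G)
    simpa [smul_eq_mul] using this
  have hγ' : orderOf γ = 2 * (2 ^ k * p) := by rw [hγ, hN, mul_assoc]
  have hρ : ρ = (γ ^ p) ^ 2 ^ k := by rw [involution_eq_pow hγ' hgen hρ1 hρ2, ← pow_mul, mul_comm]
  have hρmem : ∀ g : G, ρ * g ∈ Φ ↔ g ∉ Φ := rho_mul_mem_iff hΦ
  -- character values
  set α : ℂ := χ (Additive.ofMul (γ ^ p)) with hα_def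
  set β : ℂ := χ (Additive.ofMul (γ ^ 2 ^ (k + 1))) with hβ_def
  have hχpow : ∀ (g : G) (a : ℕ), χ (Additive.ofMul (g ^ a)) = χ (Additive.ofMul g) ^ a := fun g a => by
    rw [ofMul_pow, AddChar.map_nsmul_eq_pow]
  have hχmul : ∀ g h : G, χ (Additive.ofMul (g * h)) = χ (Additive.ofMul g) * χ (Additive.ofMul h) := fun g h => by
    rw [ofMul_mul, AddChar.map_add_eq_mul]
  have hχe : ∀ a b : ℕ, χ (Additive.ofMul ((γ ^ p) ^ a * (γ ^ 2 ^ (k + 1)) ^ b)) = α ^ a * β ^ b := fun a b => by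
    rw [hχmul, hχpow (γ ^ p) a, hχpow (γ ^ 2 ^ (k + 1)) b]
  have hαm : α ^ 2 ^ k = -1 := by rw [hα_def, ← hχpow, ← hρ, hχ]
  have hu1 : (γ ^ 2 ^ (k + 1)) ^ p = 1 := by rw [← hP]; exact pow_orderOf_eq_one _
  have hβp : β ^ p = 1 := by rw [hβ_def, ← hχpow, hu1, ofMul_one, AddChar.map_zero_eq_one]
  -- coordinates
  set e : (Fin (2 ^ k) × ZMod p) ⊕ (Fin (2 ^ k) × ZMod p) → G := fun z =>
    Sum.elim (fun xy : Fin (2 ^ k) × ZMod p => (γ ^ p) ^ (xy.1 : ℕ) * (γ ^ 2 ^ (k + 1)) ^ xy.2.val)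
      (fun xy : Fin (2 ^ k) × ZMod p => (γ ^ p) ^ ((xy.1 : ℕ) + 2 ^ k) * (γ ^ 2 ^ (k + 1)) ^ xy.2.val) z with he
  have hbij : Function.Bijective e := coord_bijective hp2 hγ hgen
  have hinr : ∀ xy : Fin (2 ^ k) × ZMod p, e (Sum.inr xy) = ρ * e (Sum.inl xy) := fun xy => by
    simp only [he, Sum.elim_inl, Sum.elim_inr]
    rw [hρ, pow_add, mul_assoc, mul_left_comm]
  -- the signs `ε(x,y) = ±1`
  set ε : Fin (2 ^ k) → ZMod p → ℤ := fun x y => if e (Sum.inl (x, y)) ∈ Φ then 1 else -1 with hε_def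
  have hmemε : ∀ x y, e (Sum.inl (x, y)) ∈ Φ ↔ ε x y = 1 := fun x y => by
    simp only [hε_def]
    split_ifs with h <;> simp [h]
  -- the character sum in coordinates
  have hsum : ∑ s ∈ Φ, χ (Additive.ofMul s) =
      ∑ x : Fin (2 ^ k), α ^ (x : ℕ) * ∑ y : ZMod p, (ε x y : ℂ) * β ^ y.val := by
    have h1 : ∑ s ∈ Φ, χ (Additive.ofMul s) = ∑ g : G, if g ∈ Φ then χ (Additive.ofMul g) else 0 := by
      rw [← Finset.sum_filter, Finset.filter_mem_eq_inter, Finset.univ_inter]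
    have h2 : (∑ g : G, if g ∈ Φ then χ (Additive.ofMul g) else 0) =
        ∑ z : (Fin (2 ^ k) × ZMod p) ⊕ (Fin (2 ^ k) × ZMod p), if e z ∈ Φ then χ (Additive.ofMul (e z)) else 0 :=
      (Fintype.sum_bijective e hbij (fun z => if e z ∈ Φ then χ (Additive.ofMul (e z)) else 0)
        (fun g => if g ∈ Φ then χ (Additive.ofMul g) else 0) fun _ => rfl).symm
    rw [h1, h2, Fintype.sum_sum_type, ← Finset.sum_add_distrib, Fintype.sum_prod_type]
    refine Finset.sum_congr rfl fun x _ => ?_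
    rw [Finset.mul_sum]
    refine Finset.sum_congr rfl fun y _ => ?_
    have hval : χ (Additive.ofMul (e (Sum.inl (x, y)))) = α ^ (x : ℕ) * β ^ y.val := by
      simp only [he, Sum.elim_inl]; exact hχe _ _
    rw [hinr (x, y)]
    by_cases hm : e (Sum.inl (x, y)) ∈ Φ
    · have hm' : ρ * e (Sum.inl (x, y)) ∉ Φ := fun h' => (hρmem _).1 h' hm
      have hεxy : (ε x y : ℂ) = 1 := by simp [hε_def, hm]
      rw [if_pos hm, if_neg hm', hval, add_zero, hεxy, one_mul]
    · have hm' : ρ * e (Sum.inl (x, y)) ∈ Φ := (hρmem _).2 hm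
      have hεxy : (ε x y : ℂ) = -1 := by simp [hε_def, hm]
      rw [if_neg hm, if_pos hm', hχmul, hχ, hval, zero_add, hεxy]
      ring
  -- independence over `ℚ(β)`: each inner sum vanishes
  have hd0 : ∀ x : Fin (2 ^ k), ∑ y : ZMod p, (ε x y : ℂ) * β ^ y.val = 0 :=
    forall_eq_zero_of_sum_pow_mul_eq_zero hp.out hp2 hαm hβp (fun x => ∑ y : ZMod p, (ε x y : ℂ) * β ^ y.val)
      (fun x => sum_mem fun y _ => mul_mem (intCast_mem ℚ⟮β⟯ (ε x y)) (pow_mem (mem_adjoin_simple_self ℚ β) _))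
      (hsum ▸ h0)
  -- `β ≠ 1`: a sum of `p` (odd) signs does not vanish
  have hβ1 : β ≠ 1 := by
    intro hβ1
    obtain ⟨x₀⟩ : Nonempty (Fin (2 ^ k)) := ⟨⟨0, by positivity⟩⟩
    have h := hd0 x₀
    simp only [hβ1, one_pow, mul_one] at h
    have hZ : (∑ y : ZMod p, ε x₀ y) = 0 := by exact_mod_cast h
    have h2 : ∀ y, ε x₀ y = 2 * (if e (Sum.inl (x₀, y)) ∈ Φ then (1 : ℤ) else 0) - 1 := fun y => by
      simp only [hε_def]; split_ifs <;> norm_num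
    rw [Finset.sum_congr rfl (fun y _ => h2 y), Finset.sum_sub_distrib, ← Finset.mul_sum, Finset.sum_const,
      Finset.card_univ, ZMod.card, nsmul_eq_mul, mul_one] at hZ
    have hdvd : (2 : ℤ) ∣ (p : ℤ) := ⟨_, (sub_eq_zero.1 hZ).symm⟩
    have hdvd' : 2 ∣ p := by exact_mod_cast hdvd
    exact hp2 ((hp.out.eq_one_or_self_of_dvd 2 hdvd').resolve_left (by norm_num)).symm
  have hβprim : IsPrimitiveRoot β p := isPrimitiveRoot_of_pow_prime_eq_one hp.out hβp hβ1
  -- `ε(x, ·)` is constant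
  have hconst : ∀ x y, ε x y = ε x 0 := fun x => by
    have h := eq_of_sum_mul_pow_eq_zero hβprim (fun y => (ε x y : ℚ)) (by
      have := hd0 x
      push_cast
      exact this)
    intro y
    exact_mod_cast h y
  -- conclusion: `uΦ = Φ`
  have hstep : ∀ xy : Fin (2 ^ k) × ZMod p, γ ^ 2 ^ (k + 1) * e (Sum.inl xy) = e (Sum.inl (xy.1, xy.2 + 1)) := by
    rintro ⟨x, y⟩
    simp only [he, Sum.elim_inl]
    rw [mul_left_comm, ← pow_succ', ZMod.val_add, ZMod.val_one,
      show (y.val + 1) % p = (y.val + 1) % orderOf (γ ^ 2 ^ (k + 1)) by rw [hP], pow_mod_orderOf]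
  intro s
  obtain ⟨z, rfl⟩ := hbij.2 s
  rcases z with ⟨x, y⟩ | ⟨x, y⟩
  · rw [hstep (x, y), hmemε, hmemε, hconst x y, hconst x (y + 1)]
  · rw [hinr (x, y), mul_left_comm, hstep (x, y), hρmem, hρmem, hmemε, hmemε, hconst x y, hconst x (y + 1)]

omit [DecidableEq G] in
/-- Conversely (the easy half), a type stable under `u` is killed by every character non-trivial on `u`
(tree `sum_char_eq_zero_of_stable`); so for an ODD character `χ` of the cyclic group of order `2^{k+1}·p`:
**`χ(Φ) = 0 ⟺ uΦ = Φ ∧ χ(u) ≠ 1`** (`χ(u) = 1` and `uΦ = Φ` would make `χ(Φ) = p · Σ_{x<2^k} ±α^x ≠ 0`).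
[cite: Hazama2003CyclicCM, Lemma 4.6.1 and Prop. 2.3] [cite: Kubota1965, §4 Lemma 2] -/
theorem sum_eq_zero_iff_isStableUnder [hp : Fact p.Prime] (hp2 : p ≠ 2) (hγ : orderOf γ = 2 ^ (k + 1) * p)
    (hgen : ∀ x : G, x ∈ Submonoid.powers γ) {Φ : Finset G} (hΦ : IsCMTypeWith ρ (Φ : Set G))
    (χ : AddChar (Additive G) ℂ) (hχ : χ (Additive.ofMul ρ) = -1) :
    ∑ s ∈ Φ, χ (Additive.ofMul s) = 0 ↔
      IsStableUnder Φ (γ ^ 2 ^ (k + 1)) ∧ χ (Additive.ofMul (γ ^ 2 ^ (k + 1))) ≠ 1 := by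
  classical
  refine ⟨fun h0 => ⟨isStableUnder_of_sum_eq_zero hp2 hγ hgen hΦ χ hχ h0, fun hβ1 => ?_⟩,
    fun ⟨hst, hβ1⟩ => sum_char_eq_zero_of_stable hst χ hβ1⟩
  -- if `χ(u) = 1`, rerun the computation: `β = 1` contradicts the vanishing (this is inside the key lemma's proof;
  -- we re-derive it through the lemma applied to `χ` itself)
  have hst := isStableUnder_of_sum_eq_zero hp2 hγ hgen hΦ χ hχ h0
  -- `χ(Φ) = Σ_{s ∈ Φ} χ(s)`; group the `u`-orbits: `χ` is constant on them (`χ(u) = 1`) and `Φ` is a union of them,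
  -- so `χ(Φ) = p · Σ_{x : reps} ±α^x`, and the involution argument of the `2`-power case applies to `G/⟨u⟩`.
  -- Shortcut: `χ` factors through the quotient by `u`; rather than building the quotient we use the coordinates.
  have hP := orderOf_pow_two_pow hγ
  have hN : 2 ^ (k + 1) = 2 * 2 ^ k := by rw [pow_succ, mul_comm]
  have hρ1 : ρ ≠ 1 := by
    intro h
    have := hΦ.rho_smul_ne (1 : G)
    rw [h, smul_eq_mul, one_mul] at this
    exact this rfl
  have hρ2 : ρ * ρ = 1 := by
    have := hΦ.invol (1 : G)
    simpa [smul_eq_mul] using this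
  have hγ' : orderOf γ = 2 * (2 ^ k * p) := by rw [hγ, hN, mul_assoc]
  have hρ : ρ = (γ ^ p) ^ 2 ^ k := by rw [involution_eq_pow hγ' hgen hρ1 hρ2, ← pow_mul, mul_comm]
  have hχpow : ∀ (g : G) (a : ℕ), χ (Additive.ofMul (g ^ a)) = χ (Additive.ofMul g) ^ a := fun g a => by
    rw [ofMul_pow, AddChar.map_nsmul_eq_pow]
  have hχmul : ∀ g h : G, χ (Additive.ofMul (g * h)) = χ (Additive.ofMul g) * χ (Additive.ofMul h) := fun g h => by
    rw [ofMul_mul, AddChar.map_add_eq_mul]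
  set α : ℂ := χ (Additive.ofMul (γ ^ p)) with hα_def
  have hαm : α ^ 2 ^ k = -1 := by rw [hα_def, ← hχpow, ← hρ, hχ]
  have hρmem : ∀ g : G, ρ * g ∈ Φ ↔ g ∉ Φ := rho_mul_mem_iff hΦ
  set e : (Fin (2 ^ k) × ZMod p) ⊕ (Fin (2 ^ k) × ZMod p) → G := fun z =>
    Sum.elim (fun xy : Fin (2 ^ k) × ZMod p => (γ ^ p) ^ (xy.1 : ℕ) * (γ ^ 2 ^ (k + 1)) ^ xy.2.val)
      (fun xy : Fin (2 ^ k) × ZMod p => (γ ^ p) ^ ((xy.1 : ℕ) + 2 ^ k) * (γ ^ 2 ^ (k + 1)) ^ xy.2.val) z with he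
  have hbij : Function.Bijective e := coord_bijective hp2 hγ hgen
  have hinr : ∀ xy : Fin (2 ^ k) × ZMod p, e (Sum.inr xy) = ρ * e (Sum.inl xy) := fun xy => by
    simp only [he, Sum.elim_inl, Sum.elim_inr]
    rw [hρ, pow_add, mul_assoc, mul_left_comm]
  -- membership of `g₂^x u^y` does not depend on `y` (stability), so define the sign by `y = 0`
  set ε : Fin (2 ^ k) → ℤ := fun x => if e (Sum.inl (x, 0)) ∈ Φ then 1 else -1 with hε_def
  have hstab : ∀ (x : Fin (2 ^ k)) (y : ZMod p), e (Sum.inl (x, y)) ∈ Φ ↔ e (Sum.inl (x, 0)) ∈ Φ := by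
    intro x y
    -- `e(inl(x,y)) = u^{y.val} · e(inl(x,0))`
    have hrel : e (Sum.inl (x, y)) = (γ ^ 2 ^ (k + 1)) ^ y.val * e (Sum.inl (x, 0)) := by
      simp only [he, Sum.elim_inl, ZMod.val_zero, pow_zero, mul_one, mul_comm]
    rw [hrel]
    exact ((hst.pow y.val) _).symm
  have hsum : ∑ s ∈ Φ, χ (Additive.ofMul s) = (p : ℂ) * ∑ x : Fin (2 ^ k), (ε x : ℂ) * α ^ (x : ℕ) := by
    have h1 : ∑ s ∈ Φ, χ (Additive.ofMul s) = ∑ g : G, if g ∈ Φ then χ (Additive.ofMul g) else 0 := by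
      rw [← Finset.sum_filter, Finset.filter_mem_eq_inter, Finset.univ_inter]
    have h2 : (∑ g : G, if g ∈ Φ then χ (Additive.ofMul g) else 0) =
        ∑ z : (Fin (2 ^ k) × ZMod p) ⊕ (Fin (2 ^ k) × ZMod p), if e z ∈ Φ then χ (Additive.ofMul (e z)) else 0 :=
      (Fintype.sum_bijective e hbij (fun z => if e z ∈ Φ then χ (Additive.ofMul (e z)) else 0)
        (fun g => if g ∈ Φ then χ (Additive.ofMul g) else 0) fun _ => rfl).symm
    rw [h1, h2, Fintype.sum_sum_type, ← Finset.sum_add_distrib, Fintype.sum_prod_type, Finset.mul_sum]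
    refine Finset.sum_congr rfl fun x _ => ?_
    have hval : ∀ y : ZMod p, χ (Additive.ofMul (e (Sum.inl (x, y)))) = α ^ (x : ℕ) := fun y => by
      simp only [he, Sum.elim_inl]
      rw [hχmul, hχpow (γ ^ p) (x : ℕ), hχpow (γ ^ 2 ^ (k + 1)) y.val, hβ1, one_pow, mul_one]
    have hterm : ∀ y : ZMod p, ((if e (Sum.inl (x, y)) ∈ Φ then χ (Additive.ofMul (e (Sum.inl (x, y)))) else 0) +
        if e (Sum.inr (x, y)) ∈ Φ then χ (Additive.ofMul (e (Sum.inr (x, y)))) else 0) = (ε x : ℂ) * α ^ (x : ℕ) := by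
      intro y
      rw [hinr (x, y)]
      by_cases hm : e (Sum.inl (x, y)) ∈ Φ
      · have hm' : ρ * e (Sum.inl (x, y)) ∉ Φ := fun h' => (hρmem _).1 h' hm
        have hεx : (ε x : ℂ) = 1 := by simp [hε_def, (hstab x y).1 hm]
        rw [if_pos hm, if_neg hm', hval, add_zero, hεx, one_mul]
      · have hm' : ρ * e (Sum.inl (x, y)) ∈ Φ := (hρmem _).2 hm
        have hm0 : e (Sum.inl (x, 0)) ∉ Φ := fun h' => hm ((hstab x y).2 h')
        have hεx : (ε x : ℂ) = -1 := by simp [hε_def, hm0]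
        rw [if_neg hm, if_pos hm', hχmul, hχ, hval, zero_add, hεx]
    rw [Finset.sum_congr rfl (fun y _ => hterm y), Finset.sum_const, Finset.card_univ, ZMod.card, nsmul_eq_mul]
  -- the `2`-power argument: `Σ_x ε_x α^x ≠ 0` (independence of `1, α, …, α^{2^k−1}` over `ℚ = ℚ(1)`)
  rw [hsum] at h0
  have hp0 : (p : ℂ) ≠ 0 := by exact_mod_cast hp.out.ne_zero
  have h0' : ∑ x : Fin (2 ^ k), α ^ (x : ℕ) * (ε x : ℂ) = 0 := by
    rw [← (mul_eq_zero.1 h0).resolve_left hp0]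
    exact Finset.sum_congr rfl fun x _ => mul_comm _ _
  have hzero := forall_eq_zero_of_sum_pow_mul_eq_zero (β := 1) hp.out hp2 hαm (one_pow p) (fun x => (ε x : ℂ))
    (fun x => intCast_mem ℚ⟮(1 : ℂ)⟯ (ε x)) h0'
  obtain ⟨x₀⟩ : Nonempty (Fin (2 ^ k)) := ⟨⟨0, by positivity⟩⟩
  have h := hzero x₀
  simp only [hε_def] at h
  split_ifs at h <;> norm_num at h

end Group

/-! ## §3 CM fields with cyclic Galois group of order `2^{k+1}·p` -/

section Field

open NumberField
open Literature.AlgebraicGeometry.Motives (AbelianVariety CMType)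
open Literature.AlgebraicGeometry.HodgeTheory
open Literature.AlgebraicGeometry.ComplexMultiplication (IsCMTypeRealisation isSimple_iff_isPrimitive
  isPrimitive_ringEquiv_complex_iff)
open Literature.AlgebraicGeometry.VanGeemen1994 (hodgeClassSpan)
open Literature.Barriers.HodgeConjecture (divisorClassesSpan)
open Literature.AlgebraicGeometry.Pohlmann1968
open Literature.AlgebraicGeometry.ComplexMultiplication.CyclicTwoPower (isNondegenerate_of_isCyclic)
open _root_.CategoryTheory _root_.CategoryTheory.Limits

variable {K : Type} [Field K] [NumberField K] [IsCMField K] [IsAbelianGalois ℚ K] {k p : ℕ}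

omit [IsCMField K] in
/-- `|Gal(K/ℚ)| = [K : ℚ]`; a generator of a cyclic Galois group has this order. [folklore] -/
private theorem orderOf_generator_eq {γ : K ≃ₐ[ℚ] K} (hγgen : ∀ x, x ∈ Subgroup.zpowers γ) :
    orderOf γ = Module.finrank ℚ K := by
  obtain ⟨φ₀⟩ := (inferInstance : Nonempty (K →+* ℂ))
  rw [orderOf_eq_card_of_forall_mem_zpowers hγgen, Nat.card_eq_fintype_card,
    Fintype.card_congr (Equiv.ofBijective (embOf φ₀) (embOf_bijective φ₀)), NumberField.Embeddings.card]

/-- **THEOREM.  Every PRIMITIVE CM type of a CM field whose Galois group is CYCLIC of order `2^{k+1}·p` (`p` an odd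
prime) is NONDEGENERATE** (Kubota rank `2^k p + 1`).  By Kubota's Lemma 2 a degenerate type is killed by an odd character
`χ`; by §2 the type read on `Gal(K/ℚ)` is then stable under the subgroup of order `p`, contradicting primitivity (Shimura
§8.2 Prop. 26 / Hazama Prop. 2.3: primitive ⟺ no non-trivial stabiliser).  For `k = 0` this is the Tankeev–Ribet–Yanai
prime theorem (tree `isNondegenerate_of_isPrimitive_of_prime`), for `p` absent the cyclic `2`-power theorem
(tree `CyclicTwoPower.isNondegenerate_of_isCyclic`). [cite: Kubota1965, §4 Lemma 2] [cite: Yanai1985, §4 Theorem (p. 171)]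
[cite: Hazama2003CyclicCM, Prop. 2.3 and Thm. 4.8 (iii)] [cite: Shimura1998, §8.2 Prop. 26] -/
theorem isNondegenerate_of_isPrimitive_of_isCyclic (hcyc : IsCyclic (K ≃ₐ[ℚ] K)) (hp : p.Prime) (hp2 : p ≠ 2)
    (hK : Module.finrank ℚ K = 2 ^ (k + 1) * p) (Φ : CMType K) (φ₀ : K →+* ℂ)
    (hprim : IsPrimitive (ℂ ≃+* ℂ) Φ.1 φ₀) : IsNondegenerate Φ := by
  classical
  haveI := Fact.mk hp
  obtain ⟨γ, hγgen⟩ := hcyc.exists_generator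
  have hgen : ∀ x : K ≃ₐ[ℚ] K, x ∈ Submonoid.powers γ := fun x => mem_powers_iff_mem_zpowers.2 (hγgen x)
  have hcomm : ∀ g h : K ≃ₐ[ℚ] K, g * h = h * g := fun g h => mul_comm g h
  have hρ : ∀ x, φ₀ ((conjGal : K ≃ₐ[ℚ] K) x) = starRingEnd ℂ (φ₀ x) := fun x =>
    IsCMField.complexEmbedding_complexConj K φ₀ x
  rw [isNondegenerate_iff_forall_oddCharacters hcomm Φ φ₀ conjGal hρ]
  intro χ hχ h0
  have hγ : orderOf γ = 2 ^ (k + 1) * p := by rw [orderOf_generator_eq hγgen, hK]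
  have hset : ({g : K ≃ₐ[ℚ] K | embOf φ₀ g ∈ Φ.1} : Set (K ≃ₐ[ℚ] K)) =
      ↑(Finset.univ.filter fun g : K ≃ₐ[ℚ] K => embOf φ₀ g ∈ Φ.1) := by
    ext g; simp
  have hcm := isCMTypeWith_gal hcomm Φ φ₀ conjGal hρ
  rw [hset] at hcm
  have hst := isStableUnder_of_sum_eq_zero hp2 hγ hgen hcm χ hχ h0
  -- the stabilising element `u = γ^{2^{k+1}}` has order `p`, so it is `≠ 1`: contradiction with primitivity
  have hu1 : γ ^ 2 ^ (k + 1) ≠ 1 := by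
    intro h
    have hP := orderOf_pow_two_pow hγ
    rw [h, orderOf_one] at hP
    exact hp.one_lt.ne hP
  exact (CyclicTwoOddPrimes.isPrimitive_iff (φ₀ := φ₀) Φ φ₀).1 hprim _ hu1 hst

/-- **Rank form**: such a primitive type has Kubota rank `2^k·p + 1`, and conversely (Kubota: nondegenerate ⟹ primitive):
**for a cyclic CM field of degree `2^{k+1}·p`, NONDEGENERATE ⟺ PRIMITIVE.** [cite: Kubota1965, §2 (p. 115) and §4 Lemma 2]
[cite: Yanai1985, §4 Theorem (p. 171)] -/
theorem isNondegenerate_iff_isPrimitive_of_isCyclic (hcyc : IsCyclic (K ≃ₐ[ℚ] K)) (hp : p.Prime) (hp2 : p ≠ 2)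
    (hK : Module.finrank ℚ K = 2 ^ (k + 1) * p) (Φ : CMType K) (φ₀ : K →+* ℂ) :
    IsNondegenerate Φ ↔ IsPrimitive (ℂ ≃+* ℂ) Φ.1 φ₀ :=
  ⟨fun h => h.isPrimitive φ₀, isNondegenerate_of_isPrimitive_of_isCyclic hcyc hp hp2 hK Φ φ₀⟩

/-- Rank of a primitive type: `Rank(Φ) = 2^k·p + 1`. [cite: Kubota1965, §4 Lemma 2] [cite: Yanai1985, §4 Theorem (p. 171)] -/
theorem cmTypeRank_eq_of_isPrimitive_of_isCyclic (hcyc : IsCyclic (K ≃ₐ[ℚ] K)) (hp : p.Prime) (hp2 : p ≠ 2)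
    (hK : Module.finrank ℚ K = 2 ^ (k + 1) * p) (Φ : CMType K) (φ₀ : K →+* ℂ)
    (hprim : IsPrimitive (ℂ ≃+* ℂ) Φ.1 φ₀) : cmTypeRank Φ = 2 ^ k * p + 1 := by
  have h := isNondegenerate_of_isPrimitive_of_isCyclic hcyc hp hp2 hK Φ φ₀ hprim
  rw [isNondegenerate_iff, hK, pow_succ, mul_assoc, mul_comm 2 p, ← mul_assoc, Nat.mul_div_cancel _ two_pos] at h
  exact h

/-- **THE CM SUBFIELDS OF A CYCLIC CM FIELD OF DEGREE `2^{k+1}·p` are `K` itself and the cyclic `2`-power CM field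
`K^{⟨u⟩}` of degree `2^{k+1}`**: a proper CM subfield `K₁ ⊊ K` has `[K : K₁] = p` and `[K₁ : ℚ] = 2^{k+1}` (in a cyclic group the
involution `ρ` lies in every subgroup of even order, and `ρ ∉ Gal(K/K₁)` for `K₁` totally complex). [cite: Dodson1984, §1.1 and §3.2.1]
[cite: Shimura1998, §18.2 Lemma (i)] -/
theorem finrank_eq_two_pow_of_isCMField_of_lt (hcyc : IsCyclic (K ≃ₐ[ℚ] K)) (hp : p.Prime)
    (hK : Module.finrank ℚ K = 2 ^ (k + 1) * p) (K₁ : IntermediateField ℚ K) (hCM : IsCMField K₁)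
    (h2 : 2 ≤ Module.finrank K₁ K) : Module.finrank K₁ K = p ∧ Module.finrank ℚ K₁ = 2 ^ (k + 1) := by
  classical
  haveI := Fact.mk hp
  obtain ⟨γ, hγgen⟩ := hcyc.exists_generator
  have hgen : ∀ x : K ≃ₐ[ℚ] K, x ∈ Submonoid.powers γ := fun x => mem_powers_iff_mem_zpowers.2 (hγgen x)
  have hγ : orderOf γ = 2 * (2 ^ k * p) := by rw [orderOf_generator_eq hγgen, hK, pow_succ]; ring
  set H : Subgroup (K ≃ₐ[ℚ] K) := K₁.fixingSubgroup with hH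
  have hcard : Nat.card H = Module.finrank K₁ K := IsGalois.card_fixingSubgroup_eq_finrank K₁
  -- `ρ ∉ H`: complex conjugation does not fix the totally complex field `K₁` pointwise
  have hρH : (conjGal : K ≃ₐ[ℚ] K) ∉ H := by
    intro hmem
    rw [hH, IntermediateField.mem_fixingSubgroup_iff] at hmem
    obtain ⟨ψ⟩ : Nonempty (K →+* ℂ) := inferInstance
    have hreal : ComplexEmbedding.IsReal (ψ.comp (algebraMap K₁ K)) := by
      rw [ComplexEmbedding.isReal_iff]
      ext x
      have hx : IsCMField.complexConj K (x : K) = x := hmem x x.2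
      have hmr : (x : K) ∈ maximalRealSubfield K := (IsCMField.complexConj_eq_self_iff K (x : K)).mp hx
      have hstar := (mem_maximalRealSubfield_iff (x : K)).mp hmr ψ
      rw [ComplexEmbedding.conjugate_coe_eq, RingHom.coe_comp, Function.comp_apply]
      rw [RCLike.star_def] at hstar
      exact hstar
    exact IsTotallyComplex.complexEmbedding_not_isReal _ hreal
  -- hence `|H|` is odd: an element of order `2` in `H` would be the unique involution `ρ = γ^{2^k p}`
  have hρ1 : (conjGal : K ≃ₐ[ℚ] K) ≠ 1 := fun h => hρH (h ▸ H.one_mem)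
  have hρeq : (conjGal : K ≃ₐ[ℚ] K) = γ ^ (2 ^ k * p) := involution_eq_pow hγ hgen hρ1 conjGal_mul_conjGal
  have hodd : ¬ 2 ∣ Module.finrank K₁ K := by
    intro hdvd
    rw [← hcard] at hdvd
    obtain ⟨g, hg⟩ := exists_prime_orderOf_dvd_card' (G := H) 2 hdvd
    have hg' : orderOf (g : K ≃ₐ[ℚ] K) = 2 := by rw [Subgroup.orderOf_coe, hg]
    have hg1 : (g : K ≃ₐ[ℚ] K) ≠ 1 := by
      intro h; rw [h, orderOf_one] at hg'; exact absurd hg' (by norm_num)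
    have hg2 : (g : K ≃ₐ[ℚ] K) * g = 1 := by rw [← pow_two, ← hg', pow_orderOf_eq_one]
    have hgeq : (g : K ≃ₐ[ℚ] K) = γ ^ (2 ^ k * p) := involution_eq_pow hγ hgen hg1 hg2
    exact hρH (by rw [hρeq, ← hgeq]; exact g.2)
  -- `[K : K₁]` is an odd divisor `≥ 2` of `2^{k+1} p`: it is `p`
  have hmul : Module.finrank ℚ K₁ * Module.finrank K₁ K = 2 ^ (k + 1) * p := by rw [Module.finrank_mul_finrank, hK]
  have hdvd : Module.finrank K₁ K ∣ 2 ^ (k + 1) * p := Dvd.intro_left _ hmul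
  have hcop : Nat.Coprime (Module.finrank K₁ K) (2 ^ (k + 1)) :=
    (Nat.Coprime.symm ((Nat.Prime.coprime_iff_not_dvd Nat.prime_two).2 hodd)).pow_right (k + 1)
  have hdvdp : Module.finrank K₁ K ∣ p := hcop.dvd_of_dvd_mul_left hdvd
  have hdeg : Module.finrank K₁ K = p := ((Nat.dvd_prime hp).1 hdvdp).resolve_left (by omega)
  refine ⟨hdeg, ?_⟩
  rw [hdeg] at hmul
  exact Nat.eq_of_mul_eq_mul_right hp.pos hmul

/-- **… and a proper CM subfield of a cyclic CM field of degree `2^{k+1}·p` is itself a CM field with CYCLIC Galois group of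
order `2^{k+1}`, all of whose CM types are nondegenerate** (tree `CyclicTwoPower.isNondegenerate_of_isCyclic`).
[cite: Kubota1965, §4 Lemma 2] [cite: Dodson1984, Prop. 5.2.2] -/
theorem isNondegenerate_of_intermediateField_of_isCyclic (hcyc : IsCyclic (K ≃ₐ[ℚ] K)) (hp : p.Prime)
    (hK : Module.finrank ℚ K = 2 ^ (k + 1) * p) (K₁ : IntermediateField ℚ K) (hCM : IsCMField K₁)
    (h2 : 2 ≤ Module.finrank K₁ K) (Φ₁ : CMType K₁) : IsNondegenerate Φ₁ := by
  haveI := hCM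
  haveI : Normal ℚ K₁ := (IsAbelianGalois.tower_bot ℚ K₁ K).toIsGalois.to_normal
  have hsurj : Function.Surjective (AlgEquiv.restrictNormalHom K₁ : (K ≃ₐ[ℚ] K) →* (K₁ ≃ₐ[ℚ] K₁)) :=
    AlgEquiv.restrictNormalHom_surjective K
  have hcyc₁ : IsCyclic (K₁ ≃ₐ[ℚ] K₁) := isCyclic_of_surjective _ hsurj
  exact isNondegenerate_of_isCyclic hcyc₁ (finrank_eq_two_pow_of_isCMField_of_lt hcyc hp hK K₁ hCM h2).2 Φ₁

/-- **THE DICHOTOMY: a CM type of a cyclic CM field of degree `2^{k+1}·p` is EITHER primitive and nondegenerate, OR induced from a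
(nondegenerate) CM type `Φ₁` of the CM subfield `K₁` of degree `2^{k+1}`, `[K : K₁] = p`.** [cite: Kubota1965, §4 Lemma 2]
[cite: Streng2010, Ch. I Lemma 3.5] [cite: Shimura1998, §8.2 Prop. 26] -/
theorem isNondegenerate_or_exists_inducedCMType_of_isCyclic (hcyc : IsCyclic (K ≃ₐ[ℚ] K)) (hp : p.Prime) (hp2 : p ≠ 2)
    (hK : Module.finrank ℚ K = 2 ^ (k + 1) * p) (Φ : CMType K) :
    IsNondegenerate Φ ∨ ∃ (K₁ : IntermediateField ℚ K) (Φ₁ : CMType K₁), IsCMField K₁ ∧ IsNondegenerate Φ₁ ∧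
      inducedCMType (algebraMap K₁ K) Φ₁ = Φ ∧ Module.finrank K₁ K = p ∧ Module.finrank ℚ K₁ = 2 ^ (k + 1) := by
  obtain ⟨φ₀⟩ : Nonempty (K →+* ℂ) := inferInstance
  by_cases hprim : IsPrimitive (ℂ ≃+* ℂ) Φ.1 φ₀
  · exact Or.inl (isNondegenerate_of_isPrimitive_of_isCyclic hcyc hp hp2 hK Φ φ₀ hprim)
  · obtain ⟨K₁, Φ₁, hCM, h₁, -, hmin⟩ := exists_primitive_inducedCMType_eq_of_isCMField Φ
    have h2 := two_le_finrank_of_not_isPrimitive hmin φ₀ hprim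
    obtain ⟨hdeg, hK₁⟩ := finrank_eq_two_pow_of_isCMField_of_lt hcyc hp hK K₁ hCM h2
    exact Or.inr ⟨K₁, Φ₁, hCM, isNondegenerate_of_intermediateField_of_isCyclic hcyc hp hK K₁ hCM h2 Φ₁, h₁, hdeg, hK₁⟩

variable {Φ : CMType K} {A : AbelianVariety ℂ} {ι : 𝓞 K →+* End A} {θ : K →+* Module.End ℂ (complexBetti A.X 1)}

/-- **`Bᵐ(Aⁿ) ⊗ ℂ = Dᵐ(Aⁿ) ⊗ ℂ` FOR EVERY POWER OF EVERY ABELIAN VARIETY WITH COMPLEX MULTIPLICATION BY A CM FIELD WITH CYCLIC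
GALOIS GROUP OF ORDER `2^{k+1}·p`** — ANY CM type, ANY realisation `(A, ι, θ)`: primitive types are nondegenerate (Hazama's
criterion, tree `IsNondegenerate.hodgeClassSpan_pow_eq_divisorClassesSpan`), imprimitive ones are induced from a nondegenerate
type of the `2`-power subfield (Hazama's criterion for induced types, tree `…_inducedCMType`).
[cite: Gordon1999HodgeAVSurvey, Thm. 6.4 and §9.3] [cite: Kubota1965, §4 Lemma 2] -/
theorem hodgeClassSpan_pow_eq_divisorClassesSpan_of_isCyclic (hcyc : IsCyclic (K ≃ₐ[ℚ] K)) (hp : p.Prime) (hp2 : p ≠ 2)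
    (hK : Module.finrank ℚ K = 2 ^ (k + 1) * p) (hA : IsCMTypeRealisation Φ A ι θ) (n m : ℕ) :
    hodgeClassSpan (⨁ fun _ : Fin n => A).dim (⨁ fun _ : Fin n => A).X m =
      divisorClassesSpan (⨁ fun _ : Fin n => A).X (⨁ fun _ : Fin n => A).dim m := by
  rcases isNondegenerate_or_exists_inducedCMType_of_isCyclic hcyc hp hp2 hK Φ with hnd | ⟨K₁, Φ₁, hCM, hnd₁, h₁, -, -⟩
  · exact hnd.hodgeClassSpan_pow_eq_divisorClassesSpan hA n m
  · haveI := hCM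
    exact hnd₁.hodgeClassSpan_pow_eq_divisorClassesSpan_inducedCMType h₁ hA n m

/-- `Bᵐ ⊗ ℂ = Dᵐ ⊗ ℂ` for all `m` on an abelian variety gives the Hodge conjecture for it (Lefschetz `(1,1)`, cup products, tree
theorems). [cite: Gordon1999HodgeAVSurvey, §9.3] -/
private theorem hodgeConjectureFor_of_forall_hodgeClassSpan_eq₆₃ (B : AbelianVariety ℂ)
    (h : ∀ m : ℕ, hodgeClassSpan B.dim B.X m = divisorClassesSpan B.X B.dim m) : HodgeConjectureFor B.dim B.X :=
  ⟨nonempty_hodgeModel_holds (Motives.AbelianVariety.isSmoothProjective_holds (A := B)),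
    fun m _ hc hmm ↦ AbelianVariety.divisorClassesSpan_le_algebraicClasses B
      (fun b hb hb' ↦ lefschetzOneOne_rational_holds (Motives.AbelianVariety.isSmoothProjective_holds (A := B)) b hb hb') m
      ((h m) ▸ Submodule.subset_span ⟨hc, hmm⟩)⟩

omit [IsCMField K] [IsAbelianGalois ℚ K] in
/-- `A ∼ ⨁_{i<1} A` (indeed isomorphic: `biproductUniqueIso`). [folklore] -/
private theorem isIsogenous_biproduct_fin_one₆₃ (B : AbelianVariety ℂ) :
    Motives.AbelianVariety.IsIsogenous B (⨁ fun _ : Fin 1 => B) :=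
  let e : B ≅ ⨁ fun _ : Fin 1 => B := (biproductUniqueIso (fun _ : Fin 1 => B)).symm
  ⟨e.hom, Motives.AbelianVariety.isIsogeny_hom_of_iso e⟩

/-- **THE HODGE CONJECTURE FOR EVERY POWER OF EVERY ABELIAN VARIETY WITH COMPLEX MULTIPLICATION BY A CM FIELD WITH CYCLIC
GALOIS GROUP OF ORDER `2^{k+1}·p`, `p` AN ODD PRIME** — UNCONDITIONAL, no primitivity or simplicity hypothesis (e.g. the
cyclotomic fields `ℚ(ζ₇)`, `ℚ(ζ₉)`, `ℚ(ζ₁₁)`, `ℚ(ζ₁₃)`, `ℚ(ζ₂₃)`, `ℚ(ζ₂₅)`, `ℚ(ζ₂₉)`, `ℚ(ζ₄₁)`, `ℚ(ζ₄₇)`, `ℚ(ζ₅₃)`, `ℚ(ζ₅₉)`,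
`ℚ(ζ₈₃)`, `ℚ(ζ₉₇)`, `ℚ(ζ₁₀₇)`, `ℚ(ζ₂₈₉)`, §4). [cite: Gordon1999HodgeAVSurvey, Thm. 6.4 and §9.3] [cite: Kubota1965, §4 Lemma 2]
[cite: Deligne2000, §1] -/
theorem hodgeConjectureFor_pow_of_isCyclic (hcyc : IsCyclic (K ≃ₐ[ℚ] K)) (hp : p.Prime) (hp2 : p ≠ 2)
    (hK : Module.finrank ℚ K = 2 ^ (k + 1) * p) (hA : IsCMTypeRealisation Φ A ι θ) (n : ℕ) :
    HodgeConjectureFor (⨁ fun _ : Fin n => A).dim (⨁ fun _ : Fin n => A).X :=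
  hodgeConjectureFor_of_forall_hodgeClassSpan_eq₆₃ _
    (fun m ↦ hodgeClassSpan_pow_eq_divisorClassesSpan_of_isCyclic hcyc hp hp2 hK hA n m)

/-- No power of such an `A` carries an exceptional Hodge class (a rational `(m,m)`-class outside `Dᵐ ⊗ ℂ`).
[cite: Gordon1999HodgeAVSurvey, Thm. 6.4] -/
theorem not_exists_exceptional_pow_of_isCyclic (hcyc : IsCyclic (K ≃ₐ[ℚ] K)) (hp : p.Prime) (hp2 : p ≠ 2)
    (hK : Module.finrank ℚ K = 2 ^ (k + 1) * p) (hA : IsCMTypeRealisation Φ A ι θ) (n m : ℕ) :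
    ¬ ∃ c : complexBetti (⨁ fun _ : Fin n => A).X (2 * m), IsRationalClass c ∧
        IsOfHodgeType (⨁ fun _ : Fin n => A).dim (⨁ fun _ : Fin n => A).X (2 * m) m m c ∧
        c ∉ divisorClassesSpan (⨁ fun _ : Fin n => A).X (⨁ fun _ : Fin n => A).dim m := by
  rintro ⟨c, hcQ, hcH, hcD⟩
  exact hcD ((hodgeClassSpan_pow_eq_divisorClassesSpan_of_isCyclic hcyc hp hp2 hK hA n m) ▸ Submodule.subset_span ⟨hcQ, hcH⟩)

/-- **The Hodge conjecture for the variety itself** (`A.dim = 2^k p`). [cite: Gordon1999HodgeAVSurvey, §9.3] [cite: Deligne2000, §1] -/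
theorem hodgeConjectureFor_of_isCyclic (hcyc : IsCyclic (K ≃ₐ[ℚ] K)) (hp : p.Prime) (hp2 : p ≠ 2)
    (hK : Module.finrank ℚ K = 2 ^ (k + 1) * p) (hA : IsCMTypeRealisation Φ A ι θ) : HodgeConjectureFor A.dim A.X :=
  HodgeConjectureFor.of_isIsogenous (isIsogenous_biproduct_fin_one₆₃ A) (hodgeConjectureFor_pow_of_isCyclic hcyc hp hp2 hK hA 1)

/-- `dim A = 2^k·p`, and `A` is SIMPLE iff its type is primitive iff nondegenerate. [cite: Shimura1998, §6.2 Thm. 3 and §8.2 Prop. 26]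
[cite: Kubota1965, §4 Lemma 2] -/
theorem dim_eq_and_isSimple_iff_isNondegenerate_of_isCyclic (hcyc : IsCyclic (K ≃ₐ[ℚ] K)) (hp : p.Prime) (hp2 : p ≠ 2)
    (hK : Module.finrank ℚ K = 2 ^ (k + 1) * p) (hA : IsCMTypeRealisation Φ A ι θ) :
    A.dim = 2 ^ k * p ∧ (A.IsSimple ↔ IsNondegenerate Φ) := by
  obtain ⟨φ₀⟩ : Nonempty (K →+* ℂ) := inferInstance
  refine ⟨?_, ?_⟩
  · have h : A.dim = Module.finrank ℚ K / 2 := Literature.AlgebraicGeometry.Motives.schemeDim_eq_holds hA.1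
    rw [h, hK, pow_succ, mul_assoc, mul_comm 2 p, ← mul_assoc, Nat.mul_div_cancel _ two_pos]
  · rw [isSimple_iff_isPrimitive hA φ₀, isNondegenerate_iff_isPrimitive_of_isCyclic hcyc hp hp2 hK Φ φ₀]

end Field

/-! ## §4 Intrinsic form, and the cyclotomic fields `ℚ(ζ_q)` with `(ℤ/q)ˣ` cyclic of order `2^{k+1}·p` -/

section Intrinsic

open NumberField
open Literature.AlgebraicGeometry.Motives
open Literature.AlgebraicGeometry.HodgeTheory
open Literature.AlgebraicGeometry.ComplexMultiplication (IsCMTypeRealisation)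
open _root_.CategoryTheory _root_.CategoryTheory.Limits

variable {K : Type} [Field K] [NumberField K] [IsCMField K] [IsAbelianGalois ℚ K] {k p : ℕ} {B : AbelianVariety ℂ}

/-- **Every complex abelian variety `B` of dimension `2^k·p` with a ring homomorphism `K → End⁰(B)`, `K` a CM field with cyclic
Galois group of order `2^{k+1}·p` (`p` an odd prime), satisfies the Hodge conjecture together with all its powers** — through the
principal pair in the isogeny class (Shimura §7.1 Prop. 7, tree `exists_principal_pair`) and §3. UNCONDITIONAL.
[cite: Shimura1998, §5.2, §7.1 Prop. 7] [cite: vanGeemen1994HodgeAV, §3.7 Lemma 3.7] [cite: Gordon1999HodgeAVSurvey, Thm. 6.4 and §9.3] -/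
theorem hodgeConjectureFor_pow_of_ringHom_of_isCyclic (hcyc : IsCyclic (K ≃ₐ[ℚ] K)) (hp : p.Prime) (hp2 : p ≠ 2)
    (hK : Module.finrank ℚ K = 2 ^ (k + 1) * p) (hB : B.dim = 2 ^ k * p) (φ : K →+* B.endAlgebra) (n : ℕ) :
    HodgeConjectureFor (⨁ fun _ : Fin n => B).dim (⨁ fun _ : Fin n => B).X := by
  obtain ⟨B', φ', ι', hφι, f, hf⟩ := exists_principal_pair φ
  have hdim' : Module.finrank ℚ K = 2 * B'.dim := by
    rw [hK, ← AbelianVariety.dim_eq_of_isIsogeny hf, hB, pow_succ]; ring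
  have hreal := isCMTypeRealisation_cmTypeOfPair φ' hdim' ι' hφι
  have hB' := hodgeConjectureFor_pow_of_isCyclic hcyc hp hp2 hK hreal n
  exact HodgeConjectureFor.of_isIsogenous
    ⟨biproduct.map fun _ : Fin n => f, AbelianVariety.IsIsogeny.biproduct_map fun _ => hf⟩ hB'

/-- **… in particular `B` itself satisfies the Hodge conjecture** (`HodgeConjectureFor (2^k·p) B.X`).
[cite: Shimura1998, §7.1 Prop. 7] [cite: vanGeemen1994HodgeAV, §3.7 Lemma 3.7] [cite: Gordon1999HodgeAVSurvey, §9.3] -/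
theorem hodgeConjectureFor_of_ringHom_of_isCyclic (hcyc : IsCyclic (K ≃ₐ[ℚ] K)) (hp : p.Prime) (hp2 : p ≠ 2)
    (hK : Module.finrank ℚ K = 2 ^ (k + 1) * p) (hB : B.dim = 2 ^ k * p) (φ : K →+* B.endAlgebra) :
    HodgeConjectureFor (2 ^ k * p) B.X := by
  obtain ⟨B', φ', ι', hφι, f, hf⟩ := exists_principal_pair φ
  have hdim' : Module.finrank ℚ K = 2 * B'.dim := by
    rw [hK, ← AbelianVariety.dim_eq_of_isIsogeny hf, hB, pow_succ]; ring
  have hreal := isCMTypeRealisation_cmTypeOfPair φ' hdim' ι' hφι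
  have h := HodgeConjectureFor.of_isIsogenous ⟨f, hf⟩ (hodgeConjectureFor_of_isCyclic hcyc hp hp2 hK hreal)
  rwa [hB] at h

end Intrinsic

section Cyclotomic

open NumberField
open Literature.AlgebraicGeometry.Motives (AbelianVariety CMType)
open Literature.AlgebraicGeometry.HodgeTheory
open Literature.AlgebraicGeometry.ComplexMultiplication (IsCMTypeRealisation)
open Literature.AlgebraicGeometry.VanGeemen1994 (hodgeClassSpan)
open Literature.Barriers.HodgeConjecture (divisorClassesSpan)
open Literature.AlgebraicGeometry.Pohlmann1968 (IsNondegenerate)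
open _root_.CategoryTheory _root_.CategoryTheory.Limits

variable {q k p : ℕ} {L : Type} [Field L] [NumberField L]
  {Φ : CMType L} {A : AbelianVariety ℂ} {ι : 𝓞 L →+* End A} {θ : L →+* Module.End ℂ (complexBetti A.X 1)}
  {B : AbelianVariety ℂ}

/-- For `L ≅ ℚ(ζ_q)`, `q > 2`, `(ℤ/q)ˣ` cyclic: `L` is a CM field, abelian over `ℚ`, with CYCLIC Galois group (`≅ (ℤ/q)ˣ`) and
`[L : ℚ] = φ(q)`. [cite: Washington1997, Ch. 2 Thm. 2.5] -/
theorem cm_abelian_cyclic_finrank_of_isCyclotomicExtension [NeZero q] (h2q : 2 < q) (hcycq : IsCyclic (ZMod q)ˣ)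
    (L : Type) [Field L] [NumberField L] [IsCyclotomicExtension {q} ℚ L] :
    IsCMField L ∧ IsAbelianGalois ℚ L ∧ IsCyclic (L ≃ₐ[ℚ] L) ∧ Module.finrank ℚ L = Nat.totient q := by
  have hirr : Irreducible (cyclotomic q ℚ) := cyclotomic.irreducible_rat (NeZero.pos q)
  exact ⟨IsCyclotomicExtension.Rat.isCMField L (S := ({q} : Set ℕ)) ⟨q, rfl, h2q⟩,
    IsCyclotomicExtension.isAbelianGalois {q} ℚ L,
    (MulEquiv.isCyclic (IsCyclotomicExtension.autEquivPow L hirr)).2 hcycq, IsCyclotomicExtension.finrank L hirr⟩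

/-- **Every primitive CM type of `ℚ(ζ_q)` is nondegenerate, when `(ℤ/q)ˣ` is cyclic of order `φ(q) = 2^{k+1}·p`** (`p` an odd
prime; `q = 25, 29, 41, 53, 97, …`). [cite: Kubota1965, §4 Lemma 2] [cite: Yanai1985, §4 Theorem (p. 171)] -/
theorem isNondegenerate_iff_isPrimitive_of_isCyclotomicExtension [NeZero q] [IsCyclotomicExtension {q} ℚ L] (h2q : 2 < q)
    (hcycq : IsCyclic (ZMod q)ˣ) (hφ : Nat.totient q = 2 ^ (k + 1) * p) (hp : p.Prime) (hp2 : p ≠ 2) (Φ : CMType L)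
    (φ₀ : L →+* ℂ) : IsNondegenerate Φ ↔ IsPrimitive (ℂ ≃+* ℂ) Φ.1 φ₀ := by
  obtain ⟨hcm, hab, hcyc, hL⟩ := cm_abelian_cyclic_finrank_of_isCyclotomicExtension h2q hcycq L
  haveI := hcm; haveI := hab
  exact isNondegenerate_iff_isPrimitive_of_isCyclic hcyc hp hp2 (hL.trans hφ) Φ φ₀

/-- **`Bᵐ(Aⁿ) ⊗ ℂ = Dᵐ(Aⁿ) ⊗ ℂ` on all powers of EVERY abelian variety with CM by `ℚ(ζ_q)`, `(ℤ/q)ˣ` cyclic of order `2^{k+1}·p`.**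
[cite: Gordon1999HodgeAVSurvey, Thm. 6.4 and §9.3] [cite: Kubota1965, §4 Lemma 2] -/
theorem hodgeClassSpan_pow_eq_divisorClassesSpan_of_isCyclotomicExtension [NeZero q] [IsCyclotomicExtension {q} ℚ L]
    (h2q : 2 < q) (hcycq : IsCyclic (ZMod q)ˣ) (hφ : Nat.totient q = 2 ^ (k + 1) * p) (hp : p.Prime) (hp2 : p ≠ 2)
    (hA : IsCMTypeRealisation Φ A ι θ) (n m : ℕ) :
    hodgeClassSpan (⨁ fun _ : Fin n => A).dim (⨁ fun _ : Fin n => A).X m =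
      divisorClassesSpan (⨁ fun _ : Fin n => A).X (⨁ fun _ : Fin n => A).dim m := by
  obtain ⟨hcm, hab, hcyc, hL⟩ := cm_abelian_cyclic_finrank_of_isCyclotomicExtension h2q hcycq L
  haveI := hcm; haveI := hab
  exact hodgeClassSpan_pow_eq_divisorClassesSpan_of_isCyclic hcyc hp hp2 (hL.trans hφ) hA n m

/-- **THE HODGE CONJECTURE FOR EVERY POWER OF EVERY ABELIAN VARIETY WITH COMPLEX MULTIPLICATION BY `ℚ(ζ_q)`, `(ℤ/q)ˣ` CYCLIC OF
ORDER `2^{k+1}·p`** (`p` an odd prime) — unconditional. [cite: Gordon1999HodgeAVSurvey, Thm. 6.4 and §9.3] [cite: Deligne2000, §1] -/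
theorem hodgeConjectureFor_pow_of_isCyclotomicExtension [NeZero q] [IsCyclotomicExtension {q} ℚ L] (h2q : 2 < q)
    (hcycq : IsCyclic (ZMod q)ˣ) (hφ : Nat.totient q = 2 ^ (k + 1) * p) (hp : p.Prime) (hp2 : p ≠ 2)
    (hA : IsCMTypeRealisation Φ A ι θ) (n : ℕ) : HodgeConjectureFor (⨁ fun _ : Fin n => A).dim (⨁ fun _ : Fin n => A).X := by
  obtain ⟨hcm, hab, hcyc, hL⟩ := cm_abelian_cyclic_finrank_of_isCyclotomicExtension h2q hcycq L
  haveI := hcm; haveI := hab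
  exact hodgeConjectureFor_pow_of_isCyclic hcyc hp hp2 (hL.trans hφ) hA n

/-- `A` itself. [cite: Gordon1999HodgeAVSurvey, §9.3] [cite: Deligne2000, §1] -/
theorem hodgeConjectureFor_of_isCyclotomicExtension [NeZero q] [IsCyclotomicExtension {q} ℚ L] (h2q : 2 < q)
    (hcycq : IsCyclic (ZMod q)ˣ) (hφ : Nat.totient q = 2 ^ (k + 1) * p) (hp : p.Prime) (hp2 : p ≠ 2)
    (hA : IsCMTypeRealisation Φ A ι θ) : HodgeConjectureFor A.dim A.X := by
  obtain ⟨hcm, hab, hcyc, hL⟩ := cm_abelian_cyclic_finrank_of_isCyclotomicExtension h2q hcycq L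
  haveI := hcm; haveI := hab
  exact hodgeConjectureFor_of_isCyclic hcyc hp hp2 (hL.trans hφ) hA

/-- The intrinsic form for `ℚ(ζ_q)`: **every complex abelian variety of dimension `2^k·p` with an action of `ℚ(ζ_q)` satisfies the
Hodge conjecture with all its powers**, `(ℤ/q)ˣ` cyclic of order `2^{k+1}·p`. [cite: Shimura1998, §7.1 Prop. 7]
[cite: Gordon1999HodgeAVSurvey, Thm. 6.4 and §9.3] -/
theorem hodgeConjectureFor_pow_of_ringHom_of_isCyclotomicExtension [NeZero q] [IsCyclotomicExtension {q} ℚ L] (h2q : 2 < q)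
    (hcycq : IsCyclic (ZMod q)ˣ) (hφ : Nat.totient q = 2 ^ (k + 1) * p) (hp : p.Prime) (hp2 : p ≠ 2)
    (hB : B.dim = 2 ^ k * p) (φ : L →+* B.endAlgebra) (n : ℕ) :
    HodgeConjectureFor (⨁ fun _ : Fin n => B).dim (⨁ fun _ : Fin n => B).X := by
  obtain ⟨hcm, hab, hcyc, hL⟩ := cm_abelian_cyclic_finrank_of_isCyclotomicExtension h2q hcycq L
  haveI := hcm; haveI := hab
  exact hodgeConjectureFor_pow_of_ringHom_of_isCyclic hcyc hp hp2 (hL.trans hφ) hB φ n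

/-! ### The levels `25` (`φ = 20 = 2²·5`), `29` (`28 = 2²·7`), `41` (`40 = 2³·5`), `53` (`52 = 2²·13`) -/

/-- `(ℤ/25)ˣ` is cyclic. [folklore] -/
private theorem isCyclic_units_twentyFive : IsCyclic (ZMod 25)ˣ := by
  exact ZMod.isCyclic_units_of_prime_pow 5 (by norm_num) (by norm_num) 2

/-- **`ℚ(ζ₂₅)`: the Hodge conjecture for every power of EVERY abelian variety with complex multiplication by `ℚ(ζ₂₅)`** (degree
`20 = 2²·5`; `(ℤ/25)ˣ` cyclic): the level of `φ(N) ≤ 22` that lit-hodgefound's censuses and the lane's `φ ≤ 16` tables do not reach.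
UNCONDITIONAL. [cite: Gordon1999HodgeAVSurvey, Thm. 6.4 and §9.3] [cite: Kubota1965, §4 Lemma 2] -/
theorem hodgeConjectureFor_pow_of_isCyclotomicExtension_twentyFive [IsCyclotomicExtension {25} ℚ L]
    (hA : IsCMTypeRealisation Φ A ι θ) (n : ℕ) : HodgeConjectureFor (⨁ fun _ : Fin n => A).dim (⨁ fun _ : Fin n => A).X :=
  hodgeConjectureFor_pow_of_isCyclotomicExtension (k := 1) (p := 5) (by norm_num) isCyclic_units_twentyFive (by decide)
    (by norm_num) (by norm_num) hA n

/-- `ℚ(ζ₂₅)`: `B•(Aⁿ) ⊗ ℂ = D•(Aⁿ) ⊗ ℂ` for every type and realisation. [cite: Gordon1999HodgeAVSurvey, Thm. 6.4] -/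
theorem hodgeClassSpan_pow_eq_divisorClassesSpan_of_isCyclotomicExtension_twentyFive [IsCyclotomicExtension {25} ℚ L]
    (hA : IsCMTypeRealisation Φ A ι θ) (n m : ℕ) :
    hodgeClassSpan (⨁ fun _ : Fin n => A).dim (⨁ fun _ : Fin n => A).X m =
      divisorClassesSpan (⨁ fun _ : Fin n => A).X (⨁ fun _ : Fin n => A).dim m :=
  hodgeClassSpan_pow_eq_divisorClassesSpan_of_isCyclotomicExtension (k := 1) (p := 5) (by norm_num) isCyclic_units_twentyFive
    (by decide) (by norm_num) (by norm_num) hA n m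

/-- `ℚ(ζ₂₅)`: nondegenerate ⟺ primitive (simple ⟺ `Rank = 11`). [cite: Kubota1965, §4 Lemma 2] -/
theorem isNondegenerate_iff_isPrimitive_of_isCyclotomicExtension_twentyFive [IsCyclotomicExtension {25} ℚ L] (Φ : CMType L)
    (φ₀ : L →+* ℂ) : IsNondegenerate Φ ↔ IsPrimitive (ℂ ≃+* ℂ) Φ.1 φ₀ :=
  isNondegenerate_iff_isPrimitive_of_isCyclotomicExtension (k := 1) (p := 5) (by norm_num) isCyclic_units_twentyFive (by decide)
    (by norm_num) (by norm_num) Φ φ₀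

/-- **`ℚ(ζ₂₅)`, intrinsic: every complex abelian TENFOLD with an action of `ℚ(ζ₂₅)` satisfies the Hodge conjecture with all its
powers.** [cite: Shimura1998, §7.1 Prop. 7] [cite: Gordon1999HodgeAVSurvey, §9.3] -/
theorem hodgeConjectureFor_pow_of_ringHom_twentyFive [IsCyclotomicExtension {25} ℚ L] (hB : B.dim = 10)
    (φ : L →+* B.endAlgebra) (n : ℕ) : HodgeConjectureFor (⨁ fun _ : Fin n => B).dim (⨁ fun _ : Fin n => B).X :=
  hodgeConjectureFor_pow_of_ringHom_of_isCyclotomicExtension (k := 1) (p := 5) (by norm_num) isCyclic_units_twentyFive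
    (by decide) (by norm_num) (by norm_num) (by rw [hB]; norm_num) φ n

/-- **`ℚ(ζ₂₉)`** (degree `28 = 2²·7`): the Hodge conjecture for every power of every abelian variety with CM by `ℚ(ζ₂₉)`.
[cite: Gordon1999HodgeAVSurvey, Thm. 6.4 and §9.3] [cite: Kubota1965, §4 Lemma 2] -/
theorem hodgeConjectureFor_pow_of_isCyclotomicExtension_twentyNine [IsCyclotomicExtension {29} ℚ L]
    (hA : IsCMTypeRealisation Φ A ι θ) (n : ℕ) : HodgeConjectureFor (⨁ fun _ : Fin n => A).dim (⨁ fun _ : Fin n => A).X :=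
  hodgeConjectureFor_pow_of_isCyclotomicExtension (q := 29) (k := 1) (p := 7) (by norm_num) (ZMod.isCyclic_units_prime (by norm_num))
    (by decide) (by norm_num) (by norm_num) hA n

/-- **`ℚ(ζ₄₁)`** (degree `40 = 2³·5`): the Hodge conjecture for every power of every abelian variety with CM by `ℚ(ζ₄₁)`.
[cite: Gordon1999HodgeAVSurvey, Thm. 6.4 and §9.3] [cite: Kubota1965, §4 Lemma 2] -/
theorem hodgeConjectureFor_pow_of_isCyclotomicExtension_fortyOne [IsCyclotomicExtension {41} ℚ L]
    (hA : IsCMTypeRealisation Φ A ι θ) (n : ℕ) : HodgeConjectureFor (⨁ fun _ : Fin n => A).dim (⨁ fun _ : Fin n => A).X :=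
  hodgeConjectureFor_pow_of_isCyclotomicExtension (q := 41) (k := 2) (p := 5) (by norm_num) (ZMod.isCyclic_units_prime (by norm_num))
    (by decide) (by norm_num) (by norm_num) hA n

/-- **`ℚ(ζ₅₃)`** (degree `52 = 2²·13`): the Hodge conjecture for every power of every abelian variety with CM by `ℚ(ζ₅₃)`.
[cite: Gordon1999HodgeAVSurvey, Thm. 6.4 and §9.3] [cite: Kubota1965, §4 Lemma 2] -/
theorem hodgeConjectureFor_pow_of_isCyclotomicExtension_fiftyThree [IsCyclotomicExtension {53} ℚ L]
    (hA : IsCMTypeRealisation Φ A ι θ) (n : ℕ) : HodgeConjectureFor (⨁ fun _ : Fin n => A).dim (⨁ fun _ : Fin n => A).X :=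
  hodgeConjectureFor_pow_of_isCyclotomicExtension (q := 53) (k := 1) (p := 13) (by norm_num) (ZMod.isCyclic_units_prime (by norm_num))
    (by decide) (by norm_num) (by norm_num) hA n

end Cyclotomic

end Literature.AlgebraicGeometry.ComplexMultiplication.CyclicTwoPowerTimesPrime

end
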